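import Summits.FinalStateConjecture.FinalStateConjecture.Theorems.BartnikGapSettlingCaptureStubClusterDispersesOfBudget
import Summits.FinalStateConjecture.FinalStateConjecture.Theorems.BartnikGapSettlingCaptureStubDispersingCaptureOfItem
import HarnessLib

/-!
# Crux `Capture` (stmt-FinalStateConjecture-10115) modulo ERA ENTRY is carried by two existing items

Line `dilated-leaves-virial-certificate` of the crux `Capture` (routes `BartnikGapSettling` /
`QuietWindowCapture` of summit `FinalStateConjecture`, same body), skeleton v3
(`Cruxes/Capture/Lines/dilated_leaves_virial_certificate.lean`), reads the crux — an MGHD of an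
admissible datum with complete `𝓘⁺` which has NEAR-SUBEXTREMAL-KERR LEAVES settles — through a rev-2
final-era package (`Literature.Geometry.Lorentzian.FinalEraPackage₂`).  Its registered stub
`stub_eraOfLeaves` (ERA ENTRY: leaves ⇒ `Nonempty (FinalEraPackage₂ 𝒟)`) is the one piece of the
line with no formal handle; this file records, free of the crux's own route files (so that a closing
file may import it), that ERA ENTRY together with the two EXISTING items of route
`DissipativeFinalMotions` already gives the crux:

  `capture_of_eraOfLeaves_of_items :
     (ERA ENTRY, the registered signature of stub_eraOfLeaves verbatim) →
     RadiativeLyapunovBudget (stmt-FinalStateConjecture-10993) →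
     DispersingCapture (stmt-FinalStateConjecture-10994) →
     (the crux, its body written over IsNearKerrLeaf — definitionally the route decl)`.

Proof: the budget disperses every package (`disperses_of_radiativeLyapunovBudget`, p120445, through
the proved item `DispersalFromBudget`, stmt-10156); the item `DispersingCapture` settles a
dispersing package (`stub_dispersingCapture_of_dispersingCapture`, p120375).  So the day an item with
the text of ERA ENTRY and the two items close, `Capture` closes in both routes by a three-line file.
(The line's own lever — leaf registration + pair Bondi ledger + the landed two-body escape
p120033/p120365/p120580 — replaces stmt-10993 exactly in the sector of at most two holes.)

No definitions, no named facts; everything is stated expanded over importable declarations.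

References: Dafermos–Luk arXiv:1710.01722, p. 8 and Conjecture 1 (final-era picture);
Dafermos–Rodnianski arXiv:0811.0354, Conj. 5.1; Marchal–Saari, J. Differential Equations 20 (1976).

Record (2026-08-17, dependency-drift repair). After the summit statement re-type T2 (2026-08-16T21:18Z)
route `DissipativeFinalMotions` RESTATED the item `DispersingCapture` in place (rev 3, 23:25Z:
stmt-FinalStateConjecture-10994 → 17643; the hypothesis gained the orientation clauses (R)/(F)/(F₀), the
conclusion the T2 conjuncts `RaysStayInClosure`, `IsFutureOriented`), and routes `BartnikGapSettling` /
`QuietWindowCapture` replaced the crux `Capture` by `SettledCapture`. The landed bridge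
`capture_of_eraOfLeaves_of_items` named `…Theses.DissipativeFinalMotions.DispersingCapture` BY NAME, so its
third antecedent silently became the rev-3 item, which the rev-2 ERA ENTRY (a `FinalEraPackage₂` WITHOUT
orientation clauses) can no longer feed: the proof stopped elaborating (full build 2026-08-17, type
mismatch at `stub_dispersingCapture_of_dispersingCapture hC`) and the statement, as now read, is no
longer a theorem of logic. Theorems files being append-only, the bridge is re-landed with the REV-2 TEXT
of `DispersingCapture` inlined verbatim (ledger signature of stmt-10994) as
`capture_of_eraOfLeaves_of_items_rev2` — same proof, same meaning as the day it landed — and the old name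
is kept as its deprecated alias. A T2 bridge (oriented era entry ⇒ `SettledCapture`) needs an era-entry
statement carrying (R)/(F)/(F₀); that is new content for the line, not recorded here.
-/

-- the doubled `FinalStateConjecture.FinalStateConjecture` path component trips dupNamespace
set_option linter.dupNamespace false

noncomputable section

namespace Summit.FinalStateConjecture.FinalStateConjecture.Theorems.BartnikGapSettling.Capture

open Set Filter Function Topology TopologicalSpace MeasureTheory
open scoped Manifold ContDiff ENNReal BigOperators
open Literature.Geometry.Lorentzian

/-- **The crux `Capture` (rev-2 reading) from ERA ENTRY, the item `RadiativeLyapunovBudget`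
(stmt-10993) and the REV-2 TEXT of `DispersingCapture` (stmt-10994, inlined verbatim from its ledger
signature; the by-name decl was restated at route rev 3, see the module docstring).** First antecedent:
the registered stub `stub_eraOfLeaves` of line `dilated-leaves-virial-certificate`, verbatim
(near-sub-extremal-Kerr leaves at every `(k, ε, K)` ⇒ the development carries a rev-2 final-era
package). Third antecedent: for an MGHD of an admissible datum with complete `𝓘⁺`, every tuple of the 18
final-era binders satisfying the 31 rev-2 clauses whose worldlines pairwise disperse yields a `C²`
`FinalStateDecomposition` of the self-determined exterior with sub-extremal holes and exhaustive charts.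
Conclusion: the rev-2 crux written over `CauchyDevelopment.IsNearKerrLeaf`. The budget disperses the
package (`disperses_of_radiativeLyapunovBudget`), the rev-2 item settles it
(`stub_dispersingCapture_of_dispersingCapture`). [cite: DafermosLuk2017, p. 8 and Conjecture 1] -/
theorem capture_of_eraOfLeaves_of_items_rev2 :
    (∀ (X : Type) [TopologicalSpace X] [ChartedSpace E3 X] [IsManifold (𝓡 3) ∞ X] [T2Space X]
      [SecondCountableTopology X] [ConnectedSpace X],
      ∀ D ∈ admissibleVacuumData X, ∀ 𝒟 : VacuumCauchyDevelopment D, 𝒟.IsMaximal →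
        Summit.FinalStateConjecture.HasCompleteNullInfinity 𝒟.toCauchyDevelopment →
          ∀ (N₀ : ℕ) (m₀ χ : ℝ) (k₁ : ℕ) (ε₁ : ℝ≥0∞), 0 < m₀ → χ < 1 → 0 < ε₁ →
            (∀ (k : ℕ) (ε : ℝ≥0∞), 0 < ε → ∀ K : Set 𝒟.carrier, IsCompact K →
              ∃ (N : ℕ) (M a : Fin N → ℝ) (S : Set 𝒟.carrier), N ≤ N₀ ∧
                (∀ i, m₀ ≤ M i ∧ M i ≤ m₀⁻¹) ∧
                  Disjoint S (𝒟.metric.causalPast 𝒟.timeOrientation K) ∧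
                    𝒟.toCauchyDevelopment.IsNearKerrLeaf k ε N M a S ∧
                      (k₁ ≤ k → ε ≤ ε₁ → ∀ i, |a i| ≤ χ * M i)) →
            Nonempty (FinalEraPackage₂ 𝒟.toCauchyDevelopment)) →
    Summit.FinalStateConjecture.FinalStateConjecture.Theses.DissipativeFinalMotions.RadiativeLyapunovBudget →
    (∀ (X : Type) [TopologicalSpace X] [ChartedSpace (EuclideanSpace ℝ (Fin 3)) X] [IsManifold (𝓡 3) ((⊤ : ℕ∞) : WithTop ℕ∞) X] [T2Space X] [SecondCountableTopology X] [ConnectedSpace X], ∀ (D : Literature.Geometry.Lorentzian.InitialDataSet (𝓡 3) X), D ∈ Literature.Geometry.Lorentzian.admissibleVacuumData X → ∀ (𝒟 : Literature.Geometry.Lorentzian.VacuumCauchyDevelopment D), 𝒟.IsMaximal → Summit.FinalStateConjecture.HasCompleteNullInfinity 𝒟.toCauchyDevelopment → ∀ (N : ℕ) (M a : Fin N → ℝ) (T δ V C₁ C₂ ρ₀ κ : ℝ) (ξ : Fin N → ℝ → EuclideanSpace ℝ (Fin 3)) (β : ℝ → ℝ) (U₀ : Opens Literature.Geometry.Lorentzian.E4)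 (B₀ : Literature.Geometry.Lorentzian.ModelBackground) (B : Fin N → Literature.Geometry.Lorentzian.ModelBackground) (Ψ₀ : B₀.domain → 𝒟.carrier) (Ψ : (i : Fin N) → (B i).domain → 𝒟.carrier) (O : Set 𝒟.carrier), O = Summit.FinalStateConjecture.exteriorOf 𝒟.toCauchyDevelopment (Ψ₀ '' B₀.lateRegion T ∪ ⋃ i, Ψ i '' (B i).lateRegion T) ∧ B₀ = Literature.Geometry.Lorentzian.Minkowski.backgroundOn U₀ ∧ (B = fun i ↦ Literature.Geometry.Lorentzian.Kerr.background (M i) (a i)) ∧ (∀ i, Literature.Geometry.Lorentzian.Kerr.IsSubextremal (M i) (a i)) ∧ 0 < δ ∧ 0 ≤ V ∧ V < 1 ∧ 0 ≤ C₁ ∧ 1 ≤ C₂ ∧ 0 < ρ₀ ∧ 0 ≤ κ ∧ (∀ i, ContDiff ℝ 2 (ξ i)) ∧ (∀ t, T ≤ t → ∀ i j, i ≠ j → δ ≤ ‖ξ i t - ξ j t‖) ∧ (∀ i s t, T ≤ s → s ≤ t → ‖ξ i t - ξ i s‖ ≤ V * (t - s)) ∧ IntegrableOn β (Ici T) ∧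 (∀ t, T ≤ t → 0 ≤ β t) ∧ (∀ t, T ≤ t → ∀ i, ‖deriv (deriv (ξ i)) t + ∑ j ∈ Finset.univ.erase i, (M j / ‖ξ i t - ξ j t‖ ^ 3) • (ξ i t - ξ j t)‖ ≤ κ * (∑ j ∈ Finset.univ.erase i, M j / ‖ξ i t - ξ j t‖ ^ 2 * (‖deriv (ξ i) t‖ ^ 2 + ‖deriv (ξ j) t‖ ^ 2 + (∑ l, M l) / ‖ξ i t - ξ j t‖)) + β t) ∧ 𝒟.toSpacetime.IsLateChart B₀ O T Ψ₀ ∧ {y : Literature.Geometry.Lorentzian.E4 | T < y 0 ∧ ∀ i, ρ₀ < ‖Literature.Geometry.Lorentzian.E4.spatial y - ξ i (y 0)‖} ⊆ (B₀.domain : Set Literature.Geometry.Lorentzian.E4) ∧ (∀ ε : ℝ, 0 < ε → ∃ ϱ T' : ℝ, ∀ τ, T' ≤ τ → Literature.Geometry.Lorentzian.supCkENorm (Subtype.val '' {y : B₀.domain | y.1 0 = τ ∧ ∀ i, ϱ ≤ ‖Literature.Geometry.Lorentzian.E4.spatial y.1 - ξ i τ‖}) 2 (𝒟.toSpacetime.deviationExtend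 B₀ Ψ₀) ≤ ENNReal.ofReal ε) ∧ (∀ i, 𝒟.toSpacetime.IsLateChart (B i) O T (Ψ i)) ∧ (∀ i (m : ℕ) (x : (B i).domain), m ≤ 2 → T ≤ x.1 0 → (B i).radius x.1 ≤ 2 * ρ₀ → ‖iteratedFDeriv ℝ m (𝒟.toSpacetime.deviationExtend (B i) (Ψ i)) x.1‖ ≤ 1 / (100 * M i ^ m)) ∧ (∀ i (R ε : ℝ), 0 < ε → ∃ D' : ℝ, ∀ T' : ℝ, (∀ t, T' ≤ t → ∀ j, j ≠ i → D' ≤ ‖ξ i t - ξ j t‖) → ∃ T'' : ℝ, ∀ τ, T'' ≤ τ → 𝒟.toSpacetime.truncDeviationCk (B i) (Ψ i) 2 R τ ≤ ENNReal.ofReal ε) ∧ (∀ i j, i ≠ j → Ψ i '' (B i).lateRegion T ∩ Ψ j '' (B j).lateRegion T ⊆ range Ψ₀) ∧ (∀ i (x : (B i).domain) (y : B₀.domain), T < x.1 0 → Ψ i x = Ψ₀ y → ‖Literature.Geometry.Lorentzian.E4.spatial y.1 - ξ i (y.1 0)‖ ≤ C₂ * (B i).radius x.1 + C₁) ∧ (∀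 i (R : ℝ), ∃ T₃ : ℝ, ∀ y : B₀.domain, T₃ < y.1 0 → ‖Literature.Geometry.Lorentzian.E4.spatial y.1 - ξ i (y.1 0)‖ ≤ R → ∃ x : (B i).domain, Ψ i x = Ψ₀ y ∧ T < x.1 0 ∧ (B i).radius x.1 ≤ C₂ * R + C₁) ∧ (∀ i (t₀ : ℝ), ∃ τ' : ℝ, Ψ i '' (B i).lateRegion τ' ∩ Ψ₀ '' {y : B₀.domain | y.1 0 ≤ t₀} = ∅) ∧ (∀ i (τ' R : ℝ), ∃ t₀ : ℝ, Ψ₀ '' {y : B₀.domain | t₀ < y.1 0} ∩ Ψ i '' {x : (B i).domain | x.1 0 ≤ τ' ∧ (B i).radius x.1 ≤ R} = ∅) ∧ (∀ τ₁, T < τ₁ → O \ (Ψ₀ '' B₀.lateRegion τ₁ ∪ ⋃ i, Ψ i '' (B i).truncLateRegion τ₁ (2 * ρ₀)) ⊆ 𝒟.toSpacetime.metric.causalPast 𝒟.toSpacetime.timeOrientation (Ψ₀ '' B₀.timeSlab τ₁ ∪ ⋃ i, Ψ i '' (B i).truncTimeSlab (2 * ρ₀) τ₁)) ∧ Pairwise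 (Disjoint on fun i ↦ Ψ i '' (B i).truncLateRegion T (2 * ρ₀)) ∧ (∀ i, Literature.Geometry.Lorentzian.Kerr.rPlus (M i) (a i) < ρ₀) → (∀ i j, i ≠ j → Tendsto (fun t ↦ ‖ξ i t - ξ j t‖) atTop atTop) → ∃ (O' : Set 𝒟.carrier) (d : Literature.Geometry.Lorentzian.FinalStateDecomposition 𝒟.toSpacetime O' 2), (∀ i, Literature.Geometry.Lorentzian.Kerr.IsSubextremal (d.mass i) (d.spin i)) ∧ O' = Summit.FinalStateConjecture.exteriorOf 𝒟.toCauchyDevelopment d.charted ∧ Summit.FinalStateConjecture.HasExhaustiveCharts d) →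
    ∀ (X : Type) [TopologicalSpace X] [ChartedSpace E3 X] [IsManifold (𝓡 3) ∞ X] [T2Space X]
      [SecondCountableTopology X] [ConnectedSpace X],
      ∀ D ∈ admissibleVacuumData X, ∀ 𝒟 : VacuumCauchyDevelopment D, 𝒟.IsMaximal →
        Summit.FinalStateConjecture.HasCompleteNullInfinity 𝒟.toCauchyDevelopment →
          (∃ (N₀ : ℕ) (m₀ χ : ℝ) (k₁ : ℕ) (ε₁ : ℝ≥0∞), 0 < m₀ ∧ χ < 1 ∧ 0 < ε₁ ∧
            ∀ (k : ℕ) (ε : ℝ≥0∞), 0 < ε → ∀ K : Set 𝒟.carrier, IsCompact K →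
              ∃ (N : ℕ) (M a : Fin N → ℝ) (S : Set 𝒟.carrier), N ≤ N₀ ∧
                (∀ i, m₀ ≤ M i ∧ M i ≤ m₀⁻¹) ∧
                  Disjoint S (𝒟.metric.causalPast 𝒟.timeOrientation K) ∧
                    𝒟.toCauchyDevelopment.IsNearKerrLeaf k ε N M a S ∧
                      (k₁ ≤ k → ε ≤ ε₁ → ∀ i, |a i| ≤ χ * M i)) →
            ∃ (O : Set 𝒟.carrier) (d : FinalStateDecomposition 𝒟.toSpacetime O 2),
              (∀ i, Kerr.IsSubextremal (d.mass i) (d.spin i)) ∧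
                O = Summit.FinalStateConjecture.exteriorOf 𝒟.toCauchyDevelopment d.charted ∧
                  Summit.FinalStateConjecture.HasExhaustiveCharts d := by
  intro h₁ hB hC X _ _ _ _ _ _ D hD 𝒟 hmax hCNI hyp
  obtain ⟨N₀, m₀, χ, k₁, ε₁, hm₀, hχ, hε₁, H⟩ := hyp
  obtain ⟨p⟩ := h₁ X D hD 𝒟 hmax hCNI N₀ m₀ χ k₁ ε₁ hm₀ hχ hε₁ H
  exact stub_dispersingCapture_of_dispersingCapture hC X D hD 𝒟 hmax hCNI p
    (disperses_of_radiativeLyapunovBudget hB X D hD 𝒟 hmax hCNI p)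

/-- Deprecated spelling: the bridge with the item `DispersingCapture` named BY NAME (landed
2026-08-16T19:18Z); since route `DissipativeFinalMotions` rev 3 (T2 re-type: orientation clauses
(R)/(F)/(F₀) in the hypothesis, `RaysStayInClosure`/`IsFutureOriented` in the conclusion) that name denotes
the rev-3 item, which the rev-2 ERA ENTRY cannot feed, so the reading stopped elaborating and is no longer a
theorem of logic; the rev-2 reading is `capture_of_eraOfLeaves_of_items_rev2`, of which the old name is
kept as a deprecated alias (Theorems files are append-only). -/
@[deprecated capture_of_eraOfLeaves_of_items_rev2 (since := "2026-08-17")]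
alias capture_of_eraOfLeaves_of_items := capture_of_eraOfLeaves_of_items_rev2

end Summit.FinalStateConjecture.FinalStateConjecture.Theorems.BartnikGapSettling.Capture

end
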